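import Summits.CriticalPhenomena.CardyFormulaZ2.Theorems.CardyComplexConeSLESixFamiliesGiveCardySmoothMarkFamiliesPart3
import HarnessLib

/-!
# Smooth-mark discretisation families, part 4: the frontier near a smooth mark and nearest frontier points

Helper file for stub `stub_smoothMarkFamilies` of line `collar-touch-sandwich` of crux
`SLESixFamiliesGiveCardy` (stmt-CriticalPhenomena-9654).  Metric facts about an open set `Ω` which
inside the ball `B(p, R)` is the strict epigraph `{a U + b V : G a < b}` (frame vectors `U, V` of a
lattice frame, `G` monotone and `1`-Lipschitz, `p = α U + G α V`):

* `mem_frontier_iff_graph`: inside `B(p, R)` the frontier of `Ω` is the graph `{a U + G a V}`;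
* `exists_param_of_frontier_near`: a frontier point near a point `z = a U + b V` of the window is a
  graph point `c U + G c V` with `|c - a|, |G c - b| ≤ dist z q`;
* `first_order_of_nearest`: if the graph point at parameter `c` is a NEAREST frontier point of
  `z = a U + b V` and `G` is differentiable at `c`, then `(c - a) + (G c - b) G'(c) = 0`;
* `not_nearest_of_lt_of_le`: consequently two points `(a, b)`, `(a', b')` with `a < a'`, `b ≤ b'`
  never share a nearest frontier point (`G' ≥ 0`).  This is the no-forcing mechanism at the cut.
-/

noncomputable section

open Set Metric
open Literature.Probability Literature.Probability.RandomPlanarGeometry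
  Literature.Probability.LatticeModels Literature.Probability.Percolation

namespace Summit.CriticalPhenomena.CardyFormulaZ2.Cruxes.SLESixFamiliesGiveCardy.CollarTouchSandwich

namespace SmoothMark

section Metric

variable {Ω : Set ℂ} {k : Fin 2} {s t : ℤ} {U V : ℂ} {G : ℝ → ℝ} {α R : ℝ} {p : ℂ}
  (hs : s = 1 ∨ s = -1) (ht : t = 1 ∨ t = -1)
  (hU : U = Site.toComplex (Pi.single k s)) (hV : V = Site.toComplex (Pi.single k.rev t))
  (hp : p = (α : ℂ) * U + ((G α : ℝ) : ℂ) * V) (hΩ : IsOpen Ω)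
  (hlip : ∀ a b, |G a - G b| ≤ |a - b|)
  (hepi : ∀ a b : ℝ, dist ((a : ℂ) * U + (b : ℂ) * V) p < R → ((a : ℂ) * U + (b : ℂ) * V ∈ Ω ↔ G a < b))

include hs ht hU hV in
/-- Frame coordinates of an arbitrary complex number. [folklore] -/
theorem eq_frame_coords (z : ℂ) :
    z = (((z * (starRingEnd ℂ) U).re : ℝ) : ℂ) * U + (((z * (starRingEnd ℂ) V).re : ℝ) : ℂ) * V := by
  rw [hU, hV]; exact frame_decomp k hs ht z

include hs ht hU hV hlip hepi in
/-- A frame point strictly below the graph (inside `B(p, R)`) is not in the closure of `Ω`: a small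
ball about it stays below the graph. [folklore] -/
theorem not_mem_closure_of_lt {a b : ℝ} (hz : dist ((a : ℂ) * U + (b : ℂ) * V) p < R) (hb : b < G a) :
    (a : ℂ) * U + (b : ℂ) * V ∉ closure Ω := by
  rw [Metric.mem_closure_iff]
  push Not
  refine ⟨min ((G a - b) / 2) (R - dist ((a : ℂ) * U + (b : ℂ) * V) p), lt_min (by linarith) (by linarith),
    fun w hw => ?_⟩
  by_contra hlt
  push Not at hlt
  rw [eq_frame_coords hs ht hU hV w] at hw hlt
  set a' : ℝ := (w * (starRingEnd ℂ) U).re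
  set b' : ℝ := (w * (starRingEnd ℂ) V).re
  obtain ⟨h1, h2⟩ := abs_sub_le_dist_frame hs ht hU hV a b a' b'
  have hlt1 := hlt.trans_le (min_le_left _ _)
  have hlt2 := hlt.trans_le (min_le_right _ _)
  have hw' : dist ((a' : ℂ) * U + (b' : ℂ) * V) p < R := by
    have := dist_triangle ((a' : ℂ) * U + (b' : ℂ) * V) ((a : ℂ) * U + (b : ℂ) * V) p
    rw [dist_comm ((a' : ℂ) * U + (b' : ℂ) * V) ((a : ℂ) * U + (b : ℂ) * V)] at this
    linarith
  have hG := hlip a a'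
  have : G a' < b' := (hepi a' b' hw').1 hw
  have ha := (abs_le.1 (h1.trans hlt1.le))
  have hb' := (abs_le.1 (h2.trans hlt1.le))
  have hG' := abs_le.1 (hG.trans (h1.trans hlt1.le))
  linarith

include hs ht hU hV hepi in
/-- A graph point inside `B(p, R)` is in the closure of `Ω` (approach it from above). [folklore] -/
theorem graph_mem_closure {a : ℝ} (hz : dist ((a : ℂ) * U + ((G a : ℝ) : ℂ) * V) p < R) :
    (a : ℂ) * U + ((G a : ℝ) : ℂ) * V ∈ closure Ω := by
  rw [Metric.mem_closure_iff]
  intro ε hε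
  set η : ℝ := min (ε / 2) ((R - dist ((a : ℂ) * U + ((G a : ℝ) : ℂ) * V) p) / 2) with hη
  have hη0 : 0 < η := lt_min (by linarith) (by linarith)
  have hd : dist ((a : ℂ) * U + ((G a : ℝ) : ℂ) * V) ((a : ℂ) * U + ((G a + η : ℝ) : ℂ) * V) = η := by
    have h := dist_sq_frame hs ht hU hV a (G a) a (G a + η)
    have h' : dist ((a : ℂ) * U + ((G a : ℝ) : ℂ) * V) ((a : ℂ) * U + ((G a + η : ℝ) : ℂ) * V) ^ 2 = η ^ 2 := by
      rw [h]; ring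
    exact (pow_left_inj₀ dist_nonneg hη0.le two_ne_zero).1 h'
  refine ⟨(a : ℂ) * U + ((G a + η : ℝ) : ℂ) * V, (hepi _ _ ?_).2 (by linarith), ?_⟩
  · have := dist_triangle ((a : ℂ) * U + ((G a + η : ℝ) : ℂ) * V) ((a : ℂ) * U + ((G a : ℝ) : ℂ) * V) p
    rw [dist_comm] at hd
    have : η ≤ (R - dist ((a : ℂ) * U + ((G a : ℝ) : ℂ) * V) p) / 2 := min_le_right _ _
    linarith
  · rw [hd]; exact (min_le_left _ _).trans_lt (by linarith)

include hs ht hU hV hΩ hlip hepi in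
/-- **The frontier near a smooth mark is the graph.** Inside `B(p, R)`, a point lies on the frontier
of `Ω` iff it is a graph point `a U + G a V`. [folklore] -/
theorem mem_frontier_iff_graph {z : ℂ} (hz : dist z p < R) :
    z ∈ frontier Ω ↔ ∃ a : ℝ, z = (a : ℂ) * U + ((G a : ℝ) : ℂ) * V := by
  rw [frontier, hΩ.interior_eq]
  constructor
  · rintro ⟨hzc, hzΩ⟩
    have hzd := eq_frame_coords hs ht hU hV z
    set a : ℝ := (z * (starRingEnd ℂ) U).re
    set b : ℝ := (z * (starRingEnd ℂ) V).re
    refine ⟨a, ?_⟩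
    rw [hzd] at hz hzc hzΩ ⊢
    rcases lt_trichotomy b (G a) with h | h | h
    · exact absurd hzc (not_mem_closure_of_lt hs ht hU hV hlip hepi hz h)
    · rw [h]
    · exact absurd ((hepi a b hz).2 h) hzΩ
  · rintro ⟨a, rfl⟩
    exact ⟨graph_mem_closure hs ht hU hV hepi hz, fun h => lt_irrefl _ ((hepi _ _ hz).1 h)⟩

include hs ht hU hV hΩ hlip hepi in
/-- **Frontier points near a window point are graph points with nearby parameter.** For
`z = a U + b V` and a frontier point `q` with `dist z p + dist z q < R`: `q = c U + G c V` with
`|a - c| ≤ dist z q` and `|b - G c| ≤ dist z q`. [folklore] -/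
theorem exists_param_of_frontier_near {a b : ℝ} {q : ℂ} (hq : q ∈ frontier Ω)
    (hzq : dist ((a : ℂ) * U + (b : ℂ) * V) p + dist ((a : ℂ) * U + (b : ℂ) * V) q < R) :
    ∃ c : ℝ, q = (c : ℂ) * U + ((G c : ℝ) : ℂ) * V ∧ |a - c| ≤ dist ((a : ℂ) * U + (b : ℂ) * V) q ∧
      |b - G c| ≤ dist ((a : ℂ) * U + (b : ℂ) * V) q := by
  have hqp : dist q p < R := by
    have := dist_triangle q ((a : ℂ) * U + (b : ℂ) * V) p
    rw [dist_comm q ((a : ℂ) * U + (b : ℂ) * V)] at this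
    linarith
  obtain ⟨c, rfl⟩ := (mem_frontier_iff_graph hs ht hU hV hΩ hlip hepi hqp).1 hq
  exact ⟨c, rfl, abs_sub_le_dist_frame hs ht hU hV a b c (G c)⟩

include hs ht hU hV hΩ hlip hepi in
/-- The distance from a point above the graph to the frontier is at most its height above the
graph (the vertical projection is a frontier point). [folklore] -/
theorem infDist_frontier_le_height {a b : ℝ} (hab : G a ≤ b)
    (hz : dist ((a : ℂ) * U + (b : ℂ) * V) p + (b - G a) < R) :
    infDist ((a : ℂ) * U + (b : ℂ) * V) (frontier Ω) ≤ b - G a := by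
  have hd : dist ((a : ℂ) * U + (b : ℂ) * V) ((a : ℂ) * U + ((G a : ℝ) : ℂ) * V) = b - G a := by
    have h := dist_sq_frame hs ht hU hV a b a (G a)
    have h' : dist ((a : ℂ) * U + (b : ℂ) * V) ((a : ℂ) * U + ((G a : ℝ) : ℂ) * V) ^ 2 = (b - G a) ^ 2 := by
      rw [h]; ring
    exact (pow_left_inj₀ dist_nonneg (by linarith) two_ne_zero).1 h'
  have hq : dist ((a : ℂ) * U + ((G a : ℝ) : ℂ) * V) p < R := by
    have := dist_triangle ((a : ℂ) * U + ((G a : ℝ) : ℂ) * V) ((a : ℂ) * U + (b : ℂ) * V) p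
    rw [dist_comm] at hd
    linarith
  rw [← hd]
  exact infDist_le_dist_of_mem ((mem_frontier_iff_graph hs ht hU hV hΩ hlip hepi hq).2 ⟨a, rfl⟩)

include hs ht hU hV hΩ hlip hepi in
/-- **First-order condition at a nearest frontier point.** If the graph point at parameter `c`
(inside `B(p, R)`) is a nearest frontier point of `z = a U + b V` and `G` is differentiable at `c`,
then `(c - a) + (G c - b) · G'(c) = 0`: the squared distance `(c' - a)² + (G c' - b)²` to the nearby
graph points, which are frontier points, has a local minimum at `c' = c`. [folklore] -/
theorem first_order_of_nearest {a b c : ℝ} (hc : dist ((c : ℂ) * U + ((G c : ℝ) : ℂ) * V) p < R)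
    (hdiff : DifferentiableAt ℝ G c)
    (hmin : dist ((a : ℂ) * U + (b : ℂ) * V) ((c : ℂ) * U + ((G c : ℝ) : ℂ) * V) =
      infDist ((a : ℂ) * U + (b : ℂ) * V) (frontier Ω)) :
    (c - a) + (G c - b) * deriv G c = 0 := by
  -- the squared distance to the graph point at parameter `c'`
  have hderiv : HasDerivAt (fun c' : ℝ => (c' - a) * (c' - a) + (G c' - b) * (G c' - b))
      ((1 * (c - a) + (c - a) * 1) + (deriv G c * (G c - b) + (G c - b) * deriv G c)) c :=
    (((hasDerivAt_id' c).sub_const a).mul ((hasDerivAt_id' c).sub_const a)).add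
      ((hdiff.hasDerivAt.sub_const b).mul (hdiff.hasDerivAt.sub_const b))
  -- nearby graph points are in `B(p, R)`
  have hG : Continuous G := by
    refine continuous_iff_continuousAt.2 fun x => Metric.continuousAt_iff.2 fun ε hε => ⟨ε, hε, fun y hy => ?_⟩
    rw [Real.dist_eq] at hy ⊢
    exact (hlip y x).trans_lt hy
  have hcont : Continuous (fun c' : ℝ => (c' : ℂ) * U + ((G c' : ℝ) : ℂ) * V) := by fun_prop
  have hev : (fun c' : ℝ => (c' : ℂ) * U + ((G c' : ℝ) : ℂ) * V) ⁻¹' ball p R ∈ nhds c :=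
    hcont.continuousAt.preimage_mem_nhds (isOpen_ball.mem_nhds (mem_ball.2 hc))
  have hloc : IsLocalMin (fun c' : ℝ => (c' - a) * (c' - a) + (G c' - b) * (G c' - b)) c := by
    filter_upwards [hev] with c' hc'
    rw [mem_preimage, mem_ball] at hc'
    have hq : (c' : ℂ) * U + ((G c' : ℝ) : ℂ) * V ∈ frontier Ω :=
      (mem_frontier_iff_graph hs ht hU hV hΩ hlip hepi hc').2 ⟨c', rfl⟩
    have h1 : dist ((a : ℂ) * U + (b : ℂ) * V) ((c : ℂ) * U + ((G c : ℝ) : ℂ) * V) ≤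
        dist ((a : ℂ) * U + (b : ℂ) * V) ((c' : ℂ) * U + ((G c' : ℝ) : ℂ) * V) := by
      rw [hmin]; exact infDist_le_dist_of_mem hq
    have e1 := dist_sq_frame hs ht hU hV a b c (G c)
    have e2 := dist_sq_frame hs ht hU hV a b c' (G c')
    have := pow_le_pow_left₀ dist_nonneg h1 2
    nlinarith [e1, e2, this]
  have h0 := hloc.hasDerivAt_eq_zero hderiv
  linarith

include hs ht hU hV hp hΩ hlip hepi in
/-- **No shared nearest frontier points.** If `G` is monotone and differentiable near the mark, two
points `z = a U + b V`, `z' = a' U + b' V` of the window with `a < a'` and `b ≤ b'` have no common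
nearest frontier point: the two first-order conditions would give `(a' - a) + (b' - b) G'(c) = 0`
with `G'(c) ≥ 0`. [folklore] -/
theorem not_nearest_of_lt_of_le (hmono : Monotone G) (hdiff : ∀ c, |c - α| < R → DifferentiableAt ℝ G c)
    {a b a' b' : ℝ} (haa : a < a') (hbb : b ≤ b') {q : ℂ} (hq : q ∈ frontier Ω)
    (hz : dist ((a : ℂ) * U + (b : ℂ) * V) p + dist ((a : ℂ) * U + (b : ℂ) * V) q < R)
    (hmin : dist ((a : ℂ) * U + (b : ℂ) * V) q = infDist ((a : ℂ) * U + (b : ℂ) * V) (frontier Ω))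
    (hmin' : dist ((a' : ℂ) * U + (b' : ℂ) * V) q = infDist ((a' : ℂ) * U + (b' : ℂ) * V) (frontier Ω)) :
    False := by
  obtain ⟨c, rfl, -, -⟩ := exists_param_of_frontier_near hs ht hU hV hΩ hlip hepi hq hz
  have hcp : dist ((c : ℂ) * U + ((G c : ℝ) : ℂ) * V) p < R := by
    have := dist_triangle ((c : ℂ) * U + ((G c : ℝ) : ℂ) * V) ((a : ℂ) * U + (b : ℂ) * V) p
    rw [dist_comm ((c : ℂ) * U + ((G c : ℝ) : ℂ) * V) ((a : ℂ) * U + (b : ℂ) * V)] at this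
    linarith
  have hcα : |c - α| < R := by
    have h := (abs_sub_le_dist_frame hs ht hU hV c (G c) α (G α)).1
    rw [← hp] at h
    exact h.trans_lt hcp
  have hd := hdiff c hcα
  have h1 := first_order_of_nearest hs ht hU hV hΩ hlip hepi hcp hd hmin
  have h2 := first_order_of_nearest hs ht hU hV hΩ hlip hepi hcp hd hmin'
  have hG' : 0 ≤ deriv G c := hd.hasDerivAt.nonneg_of_monotone hmono
  nlinarith

end Metric

end SmoothMark

/-! ### Registered sub-goal (one-line signature, verbatim) -/

/-- **Registered sub-goal `smoothMark_part4` of `stub_smoothMarkFamilies`**: two window points `(a, b)`, `(a', b')` with `a < a'`, `b ≤ b'` never share a nearest frontier point. [folklore] -/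
theorem smoothMark_part4 : ∀ (Ω : Set ℂ) (k : Fin 2) (s t : ℤ) (U V : ℂ) (G : ℝ → ℝ) (α R : ℝ) (p : ℂ), (s = 1 ∨ s = -1) → (t = 1 ∨ t = -1) → U = Site.toComplex (Pi.single k s) → V = Site.toComplex (Pi.single k.rev t) → p = (α : ℂ) * U + ((G α : ℝ) : ℂ) * V → IsOpen Ω → (∀ a b, |G a - G b| ≤ |a - b|) → (∀ a b : ℝ, dist ((a : ℂ) * U + (b : ℂ) * V) p < R → ((a : ℂ) * U + (b : ℂ) * V ∈ Ω ↔ G a < b)) → Monotone G → (∀ c, |c - α| < R → DifferentiableAt ℝ G c) → ∀ (a b a' b' : ℝ), a < a' → b ≤ b' → ∀ q ∈ frontier Ω, dist ((a : ℂ) * U + (b : ℂ) * V) p + dist ((a : ℂ) * U + (b : ℂ) * V) q < R → dist ((a : ℂ) * U + (b : ℂ) * V) q = Metric.infDist ((a : ℂ) * U + (b : ℂ) * V) (frontier Ω) → dist ((a' : ℂ) * U + (b' : ℂ) * V) q = Metric.infDist ((a' : ℂ) * U + (b' : ℂ) * V) (frontier Ω) → False :=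
  fun _ _ _ _ _ _ _ _ _ _ hs ht hU hV hp hΩ hlip hepi hmono hdiff _ _ _ _ haa hbb _ hq hz hmin hmin' =>
    SmoothMark.not_nearest_of_lt_of_le hs ht hU hV hp hΩ hlip hepi hmono hdiff haa hbb hq hz hmin hmin'

end Summit.CriticalPhenomena.CardyFormulaZ2.Cruxes.SLESixFamiliesGiveCardy.CollarTouchSandwich

end
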